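import Summits.SmoothPoincare4.SmoothPoincare4.Theorems.ConvexBisectionAcyclicBisectionRigidityCancelPair
import Literature.Topology.FourManifolds.ClosedAsCobordism
import HarnessLib

/-!
# Cancelling a transverse `k/(k+1)` pair of a nice Morse function on a closed manifold

Helper file (crux `ConvexBisection.AcyclicBisectionRigidity`, item stmt-SmoothPoincare4-10507,
line `seam-duality-cancellation`; re-land of lead c1's lost `CancelPairClosed`).  The GSC lever of
the line cancels 1-handles of one half of a Stein bisection against dual 2-handles of the other
half.  Milnor's First Cancellation Theorem in any index is the tree's
`Cancellation.cancel_pair_of_isTransverseInLevel` (file `…CancelPair.lean`), stated for a nice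
Morse function on a COBORDISM.  This file is its CLOSED-MANIFOLD packaging:

* `exists_isMorse_of_cancelPair` — let `X` be a closed `(n+1)`-manifold, regarded as the
  cobordism `(X; ∅, ∅) = Cobordism.ofClosed n X` (total space the chart synonym
  `HalfSpaceCharted X`, `ClosedAsCobordism.lean`), `g` a nice Morse function on it with a smooth
  gradient-like field `ξ`, and `p`, `q` critical points of indices `k`, `k + 1` whose right-hand
  and left-hand spheres in Milnor's level `V_{k+} = g⁻¹(plusLevel n k)` meet in one point,
  transversely.  Then `X` carries a Morse function `F'` (for the boundaryless model `𝓡 (n + 1)`)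
  with one critical point of index `k` fewer than `g`, one of index `k + 1` fewer, and as many of
  every other index.  Proof: cancel `p`, `q` on the cobordism (`cancel_pair_of_isTransverseInLevel`:
  a nice `g'` with `crit g' = crit g ∖ {p, q}` and the old indices), read `g'` on `X` through the
  identity `HalfSpaceCharted.of : X ≃ HalfSpaceCharted X` (`HalfSpaceCharted.isMorse_iff`,
  `HalfSpaceCharted.ncard_criticalSetOfIndex_eq`: Morse-ness, critical points and indices do not
  depend on the atlas, Milnor 1963 §2), and count (`criticalSetOfIndex_eq_diff_of_criticalSet_eq_diff`).

Everything is proved; no definitions, no named facts.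

## References

* J. Milnor, *Lectures on the h-cobordism theorem*, Princeton (1965), Thm. 5.4 (PDF p. 27), §1
  (closed manifolds as triads `(W; ∅, ∅)`). [MilnorHCobordism1965]
* J. Milnor, *Morse theory*, Ann. of Math. Studies 51 (1963), §2. [Milnor1963]
-/

open scoped Manifold ContDiff Topology
open Set Function Filter

noncomputable section

-- the prescribed namespace `Summit.<P>.<Sub>.…` duplicates `SmoothPoincare4` (P = Sub)
set_option linter.dupNamespace false

namespace Summit.SmoothPoincare4.SmoothPoincare4.Theorems.AcyclicBisectionRigidity.Cancellation

open Literature.Topology.FourManifolds Literature.Topology.FourManifolds.Cobordism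
open Literature.Topology.FourManifolds.HalfSpaceCharted

universe u

section Closed

variable {n : ℕ} {X : Type u} [TopologicalSpace X] [T2Space X] [SecondCountableTopology X]
  [CompactSpace X] [ChartedSpace (EuclideanSpace ℝ (Fin (n + 1))) X] [IsManifold (𝓡 (n + 1)) ∞ X]

/-- **Milnor's First Cancellation Theorem on a closed manifold, counted by index** (Milnor 1965,
Thm. 5.4, for the triad `(X; ∅, ∅)` of §1).  Let `g` be a nice Morse function on the cobordism
`Cobordism.ofClosed n X` of a closed `(n+1)`-manifold `X`, `ξ` a smooth gradient-like field,
`p`, `q` critical points of indices `k`, `k + 1` whose right-hand sphere, resp. left-hand sphere,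
in the level `g⁻¹(plusLevel n k)` meet in exactly one point `x₀`, transversely.  Then there is a
Morse function `F'` on `X` with `#Crit_k(F') + 1 = #Crit_k(g)`, `#Crit_{k+1}(F') + 1 = #Crit_{k+1}(g)`
and `#Crit_i(F') = #Crit_i(g)` for every other index `i`: cancel the pair on the cobordism
(`cancel_pair_of_isTransverseInLevel`) and read the new nice Morse function on `X` along the
identity `HalfSpaceCharted.of`, which preserves Morse functions, critical points and indices.
[cite: MilnorHCobordism1965, Thm. 5.4 (PDF p. 27); §1 (the case V₀ = V₁ = ∅)] -/
theorem exists_isMorse_of_cancelPair {g : (Cobordism.ofClosed n X).W → ℝ}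
    (hg : (Cobordism.ofClosed n X).IsNiceMorseFunction g)
    (ξ : Cₛ^∞⟮𝓡∂ (n + 1); EuclideanSpace ℝ (Fin (n + 1)),
      (TangentSpace (𝓡∂ (n + 1)) : (Cobordism.ofClosed n X).W → Type)⟯)
    (hξ : IsGradientLike (𝓡∂ (n + 1)) g ξ) {p q : (Cobordism.ofClosed n X).W} {k : ℕ}
    (hp : p ∈ criticalSetOfIndex (𝓡∂ (n + 1)) g k)
    (hq : q ∈ criticalSetOfIndex (𝓡∂ (n + 1)) g (k + 1)) {x₀ : (Cobordism.ofClosed n X).W}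
    (hx₀ : rightHandSphere (𝓡∂ (n + 1)) g ξ p (plusLevel n k) ∩
      leftHandSphere (𝓡∂ (n + 1)) g ξ q (plusLevel n k) = {x₀})
    (htr : IsTransverseInLevel (𝓡∂ (n + 1)) (g ⁻¹' {plusLevel n k})
      (rightHandSphere (𝓡∂ (n + 1)) g ξ p (plusLevel n k))
      (leftHandSphere (𝓡∂ (n + 1)) g ξ q (plusLevel n k)) x₀) :
    ∃ F' : X → ℝ, IsMorse (𝓡 (n + 1)) F' ∧
      (criticalSetOfIndex (𝓡 (n + 1)) F' k).ncard + 1 =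
          (criticalSetOfIndex (𝓡∂ (n + 1)) g k).ncard ∧
      (criticalSetOfIndex (𝓡 (n + 1)) F' (k + 1)).ncard + 1 =
          (criticalSetOfIndex (𝓡∂ (n + 1)) g (k + 1)).ncard ∧
      ∀ i, i ≠ k → i ≠ k + 1 →
        (criticalSetOfIndex (𝓡 (n + 1)) F' i).ncard =
          (criticalSetOfIndex (𝓡∂ (n + 1)) g i).ncard := by
  -- Step 1 (Milnor's Thm. 5.4 with 4.2 and 4.8, the tree's `cancel_pair_of_isTransverseInLevel`):
  -- cancel `p` against `q` on the cobordism `(X; ∅, ∅)`.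
  obtain ⟨g', hg', hcrit, hind⟩ := cancel_pair_of_isTransverseInLevel hg ξ hξ hp hq hx₀ htr
  -- Step 2: bookkeeping of the critical points of each index on the cobordism.
  have hS : ∀ i, criticalSetOfIndex (𝓡∂ (n + 1)) g' i =
      criticalSetOfIndex (𝓡∂ (n + 1)) g i \ {p, q} :=
    criticalSetOfIndex_eq_diff_of_criticalSet_eq_diff hcrit hind
  have hfin : ∀ i, (criticalSetOfIndex (𝓡∂ (n + 1)) g i).Finite :=
    hg.isMorseFunction.finite_criticalSetOfIndex
  have hqk : q ∉ criticalSetOfIndex (𝓡∂ (n + 1)) g k := fun h => by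
    have h' := h.2.symm.trans hq.2
    omega
  have hpk : p ∉ criticalSetOfIndex (𝓡∂ (n + 1)) g (k + 1) := fun h => by
    have h' := h.2.symm.trans hp.2
    omega
  -- Step 3: read `g'` on `X` along the identity `of : X ≃ HalfSpaceCharted X = (X; ∅, ∅).W`.
  set F' : X → ℝ := fun x => g' (of x) with hF'
  have hgM : IsMorse (𝓡∂ (n + 1)) (F' ∘ of.symm) := hg'.isMorseFunction.isMorse
  have hF'M : IsMorse (𝓡 (n + 1)) F' := (isMorse_iff (n := n) (X := X) (f := F')).1 hgM
  have hF'2 : ContMDiff (𝓡 (n + 1)) 𝓘(ℝ, ℝ) 2 F' := hF'M.contMDiff.of_le (by norm_cast)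
  have hcount : ∀ i, (criticalSetOfIndex (𝓡 (n + 1)) F' i).ncard =
      (criticalSetOfIndex (𝓡∂ (n + 1)) g i \ {p, q}).ncard := fun i => by
    rw [← ncard_criticalSetOfIndex_eq hF'2 i, ← hS i]
    rfl
  -- Step 4: count.
  refine ⟨F', hF'M, ?_, ?_, fun i hik hik' => ?_⟩
  · rw [hcount k, pair_comm, sdiff_insert_of_notMem hqk, ncard_sdiff_singleton_add_one hp (hfin k)]
  · rw [hcount (k + 1), sdiff_insert_of_notMem hpk, ncard_sdiff_singleton_add_one hq (hfin (k + 1))]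
  · have hpi : p ∉ criticalSetOfIndex (𝓡∂ (n + 1)) g i := fun h => hik (h.2.symm.trans hp.2)
    have hqi : q ∉ criticalSetOfIndex (𝓡∂ (n + 1)) g i := fun h => hik' (h.2.symm.trans hq.2)
    rw [hcount i, sdiff_insert_of_notMem hpi, sdiff_singleton_eq_self hqi]

end Closed

end Summit.SmoothPoincare4.SmoothPoincare4.Theorems.AcyclicBisectionRigidity.Cancellation

end
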